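import Summits.ValiantsHypothesis.ValiantsHypothesis.Theorems.KPlusLogSqLawValuativeDoorRankOneLawFalse

/-!
# LINE `valuative_door` (crux `WeakLifting`, stmt-ValiantsHypothesis-19561) — NO POLYNOMIAL VALUATIVE FEWNOMIAL LAW for lacunary matrix
# determinants: the valuative census row cannot be bounded by `(m·K)^C`, neither for general nor for symmetric pencils

HONEST FRAMING.  Helper (cell `pub-symmetroid`, seat val-sym-lift-p1 g22, 2026-08-29; `--supports 19561 --as helper`).  Calibration of the SHAPE
of the line's valuative laws (vB = `ValKLaw` has the budget `2^{C (K + ⌊log₂ m⌋²)}`): the Gajjar–Radhakrishnan / Carstensen path pencils of the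
lane `…RankOneLawFalse` (general `(k, K)` pencils over `(ℝ, |·|₂)` with `K ≤ (k+1)² + 1` letters and `≥ n^m − 1` Newton edges, `k + 1 ≤
3^m (1 + mn) + 1`, every `n ≥ 2`, `m`) show that NO bound of the form `(m·K)^C` holds for the skeleton's `GenValRootLawAt` (general pencils,
`not_poly_genValRootLaw_unfolded`) nor — by `symmetryVoid_unfolded` (p700868) — for `ValRootLawAt` (symmetric pencils,
`not_poly_valRootLaw_unfolded`): `¬ ∃ C, ∀ m K, ValRootLawAt m K ((m·K)^C)`.  This does NOT touch vB / vW (their budget is exponential in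
`K`, and here `K ~ k²`), `WeakLifting` 19561, `MatrixDescartes` 18050 or VP ≠ VNP — all OPEN; it records that any valuative law for
lacunary symmetric determinants must be super-polynomial in the format.  [assembly of the lane's kernel pieces]
-/

set_option linter.dupNamespace false
set_option autoImplicit false

namespace Summit.ValiantsHypothesis.ValiantsHypothesis.Theorems.KPlusLogSqLaw.ValDoor

open Polynomial Finset Matrix
open scoped BigOperators Classical
open Literature.Combinatorics.Optimization
open Literature.Combinatorics.Optimization.ParamDAG
open Literature.Computability.AlgebraicComplexity (hessNeg)

/-- **NO POLYNOMIAL VALUATIVE LAW FOR GENERAL LACUNARY MATRIX PENCILS**: there is no `C` with `npEdges ≤ (m·K)^C` for all general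
`(m, K)` pencils over all non-archimedean fields of characteristic zero (the skeleton's `GenValRootLawAt m K ((m K)^C)` for all `m K`,
unfolded). -/
theorem not_poly_genValRootLaw_unfolded :
    ¬ ∃ Cst : ℕ, ∀ (m K : ℕ) (F : Type) [Field F] [CharZero F] (v : AbsoluteValue F ℝ), IsNonarchimedean v →
      ∀ (d : Fin K → ℕ) (M : Fin K → Matrix (Fin m) (Fin m) F),
        ((Matrix.det (∑ l, ((Polynomial.X : Polynomial F) ^ d l) • (M l).map Polynomial.C)).support.filter fun E =>
            ∃ r : ℝ, 0 < r ∧ ∀ E' ∈ (Matrix.det (∑ l, ((Polynomial.X : Polynomial F) ^ d l) • (M l).map Polynomial.C)).support,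
              E' ≠ E →
              v ((Matrix.det (∑ l, ((Polynomial.X : Polynomial F) ^ d l) • (M l).map Polynomial.C)).coeff E') * r ^ E'
                < v ((Matrix.det (∑ l, ((Polynomial.X : Polynomial F) ^ d l) • (M l).map Polynomial.C)).coeff E) * r ^ E).card - 1
          ≤ (m * K) ^ Cst := by
  rintro ⟨C, hC⟩
  obtain ⟨w, hw, hw2⟩ := twoAdicOnReals_unfolded
  set m : ℕ := 4 * C + 1 with hm
  set n : ℕ := 8 ^ C * (3 ^ (4 * C + 2) * (4 * C + 2)) ^ (4 * C) + 2 with hn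
  obtain ⟨k, G, P, u, hk, hP, hwa, hwb, hlead⟩ := exists_paramDAG_strictLeads_nat n m (by rw [hn]; omega)
  choose a ha using hwa
  choose b hb using hwb
  obtain ⟨K, d, M, hK, hpencil⟩ := exists_pencil_eq_hessNeg G a b
  have hcount := le_card_dominant_pathPoly G a b ha hb P hP u hlead w hw hw2
  have hbound := hC k K ℝ w hw d M
  rw [← hpencil, det_hessNeg_labels G a b] at hbound
  have harith := budget_lt C k K (by rw [hm, hn] at hk; exact hk) hK
  rw [← hn, ← hm] at harith
  have hmono : (k * K) ^ C ≤ (2 * k * (K * (2 * k))) ^ C := by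
    refine Nat.pow_le_pow_left ?_ C
    rcases Nat.eq_zero_or_pos k with h0 | hpos
    · rw [h0]; simp
    · calc k * K ≤ (2 * k) * K := Nat.mul_le_mul_right K (by omega)
        _ = 2 * k * (K * 1) := by ring
        _ ≤ 2 * k * (K * (2 * k)) := Nat.mul_le_mul_left _ (Nat.mul_le_mul_left K (by omega))
  omega

/-- **NO POLYNOMIAL VALUATIVE LAW FOR SYMMETRIC LACUNARY PENCILS EITHER** (`¬ ∃ C, ∀ m K, ValRootLawAt m K ((m K)^C)`, unfolded):
symmetry is void up to `m ↦ 2m` (`symmetryVoid_unfolded`). -/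
theorem not_poly_valRootLaw_unfolded :
    ¬ ∃ Cst : ℕ, ∀ (m K : ℕ) (F : Type) [Field F] [CharZero F] (v : AbsoluteValue F ℝ), IsNonarchimedean v →
      ∀ (d : Fin K → ℕ) (S : Fin K → Matrix (Fin m) (Fin m) F), (∀ l, (S l).IsSymm) →
        ((Matrix.det (∑ l, ((Polynomial.X : Polynomial F) ^ d l) • (S l).map Polynomial.C)).support.filter fun E =>
            ∃ r : ℝ, 0 < r ∧ ∀ E' ∈ (Matrix.det (∑ l, ((Polynomial.X : Polynomial F) ^ d l) • (S l).map Polynomial.C)).support,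
              E' ≠ E →
              v ((Matrix.det (∑ l, ((Polynomial.X : Polynomial F) ^ d l) • (S l).map Polynomial.C)).coeff E') * r ^ E'
                < v ((Matrix.det (∑ l, ((Polynomial.X : Polynomial F) ^ d l) • (S l).map Polynomial.C)).coeff E) * r ^ E).card - 1
          ≤ (m * K) ^ Cst := by
  rintro ⟨C, hC⟩
  obtain ⟨w, hw, hw2⟩ := twoAdicOnReals_unfolded
  -- symmetric law at (2k', K) ⇒ general law at (k', K) with budget (2k'·K)^C
  have hgen : ∀ (k' K : ℕ) (d : Fin K → ℕ) (M : Fin K → Matrix (Fin k') (Fin k') ℝ),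
      ((Matrix.det (∑ l, ((Polynomial.X : Polynomial ℝ) ^ d l) • (M l).map Polynomial.C)).support.filter fun E =>
          ∃ r : ℝ, 0 < r ∧ ∀ E' ∈ (Matrix.det (∑ l, ((Polynomial.X : Polynomial ℝ) ^ d l) • (M l).map Polynomial.C)).support,
            E' ≠ E →
            w ((Matrix.det (∑ l, ((Polynomial.X : Polynomial ℝ) ^ d l) • (M l).map Polynomial.C)).coeff E') * r ^ E'
              < w ((Matrix.det (∑ l, ((Polynomial.X : Polynomial ℝ) ^ d l) • (M l).map Polynomial.C)).coeff E) * r ^ E).card - 1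
        ≤ (2 * k' * K) ^ C :=
    fun k' K d M => symmetryVoid_unfolded k' K ((2 * k' * K) ^ C) (fun F _ _ v hv d S hS => hC (2 * k') K F v hv d S hS) ℝ w hw d M
  set m : ℕ := 4 * C + 1 with hm
  set n : ℕ := 8 ^ C * (3 ^ (4 * C + 2) * (4 * C + 2)) ^ (4 * C) + 2 with hn
  obtain ⟨k, G, P, u, hk, hP, hwa, hwb, hlead⟩ := exists_paramDAG_strictLeads_nat n m (by rw [hn]; omega)
  choose a ha using hwa
  choose b hb using hwb
  obtain ⟨K, d, M, hK, hpencil⟩ := exists_pencil_eq_hessNeg G a b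
  have hcount := le_card_dominant_pathPoly G a b ha hb P hP u hlead w hw hw2
  have hbound := hgen k K d M
  rw [← hpencil, det_hessNeg_labels G a b] at hbound
  have harith := budget_lt C k K (by rw [hm, hn] at hk; exact hk) hK
  rw [← hn, ← hm] at harith
  have hmono : (2 * k * K) ^ C ≤ (2 * k * (K * (2 * k))) ^ C := by
    refine Nat.pow_le_pow_left ?_ C
    rcases Nat.eq_zero_or_pos k with h0 | hpos
    · rw [h0]; simp
    · calc 2 * k * K = 2 * k * (K * 1) := by ring
        _ ≤ 2 * k * (K * (2 * k)) := Nat.mul_le_mul_left _ (Nat.mul_le_mul_left K (by omega))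
  omega

end Summit.ValiantsHypothesis.ValiantsHypothesis.Theorems.KPlusLogSqLaw.ValDoor
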